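import Mathlib.NumberTheory.Padics.RingHoms
import Mathlib.NumberTheory.Padics.ProperSpace
import Mathlib.Analysis.Normed.Ring.Units
import Mathlib.Analysis.SpecificLimits.Normed
import Mathlib.Topology.Algebra.Group.Basic
import Mathlib.Topology.MetricSpace.Ultra.Basic
import Mathlib.Topology.MetricSpace.Ultra.TotallySeparated
import Mathlib.GroupTheory.Index
import Mathlib.RingTheory.LocalRing.Basic
import HarnessLib

/-!
# The `p`-adic affine group `Aff(ℤ_p) = ℤ_p ⋊ ℤ_pˣ`: a compact, totally disconnected topological
# group all of whose open subgroups have trivial centraliser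

Topic `Literature/GroupTheory/SpecificGroups`.  Classical («folklore») material recorded as a
concrete WITNESS: the group of affine substitutions `x ↦ u x + a` (`a ∈ ℤ_p`, `u ∈ ℤ_pˣ`) of the
`p`-adic integers, with the topology of `ℤ_p × ℤ_p` on the coordinates `(a, u)`, is a compact,
Hausdorff, totally disconnected topological group (a profinite group); its congruence subgroups
`Γ_n = {(a, u) : a ≡ 0, u ≡ 1 (mod pⁿ)}` are open normal of finite index `≥ pⁿ` and form a basis of
neighbourhoods of `1`; and it is SLIM in the sense of Mochizuki ([FrdI] §0 p. 13: «the centraliser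
of every open subgroup is trivial»): an element commuting with `(pⁿ, 1)` and `(0, 1 - pⁿ)` is the
identity.  (Reference for the semidirect-product / congruence-subgroup formalism:
L. Ribes, P. Zalesskii, *Profinite Groups*, 2nd ed., Springer 2010, §2.1 and Ex. 2.1.6 (profinite
completions and congruence bases); the slimness computation is elementary and carried out here.)

Citation policy of this file: the `[cite: …]` tags locate the DEFINITION being instantiated —
«slim» topological groups, [SemiAnbd] §0 p. 6 / [FrdI] §0 p. 13 — not a published treatment of
this particular example; the verification that `Aff(ℤ_p)` satisfies it is an elementary
computation carried out here (OUR kernel check, no published claim is asserted).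

Purpose in the tree (cell abc-iut, layer L3): a kernel-checked model for the vertex groups of a
semi-graph of anabelioids satisfying the hypotheses of [SemiAnbd] Prop. 3.6 / Thm. 3.7 (companion
file `Literature/AnabelianGeometry/SemiGraphs/Prop36HypothesesWitness.lean`): such vertex groups
must be slim, infinite, with finite quotients of unbounded order.  Mathlib only: no statement of
any IUT paper is touched here.
-/

noncomputable section

namespace Literature.GroupTheory.SpecificGroups

open Topology Filter Set

universe u

variable (p : ℕ) [Fact p.Prime]

/-- The `p`-adic affine group `Aff(ℤ_p)`: pairs `(a, u)` with `a ∈ ℤ_p`, `u ∈ ℤ_pˣ`, i.e. the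
substitutions `x ↦ u x + a`; multiplication `(a, u) · (b, w) = (a + u b, u w)`. [cite: MochizukiSemiAnbd2006, §0 p.6] -/
@[ext] structure PadicAffine : Type where
  /-- the translation part `a ∈ ℤ_p` -/
  a : ℤ_[p]
  /-- the linear part `u ∈ ℤ_pˣ` -/
  u : ℤ_[p]ˣ

namespace PadicAffine

variable {p}

/-- Multiplication `(a, u) · (b, w) = (a + u b, u w)` (composition of substitutions). [cite: MochizukiSemiAnbd2006, §0 p.6] -/
instance : Mul (PadicAffine p) := ⟨fun x y => ⟨x.a + (x.u : ℤ_[p]) * y.a, x.u * y.u⟩⟩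

/-- The identity substitution `(0, 1)`. [cite: MochizukiSemiAnbd2006, §0 p.6] -/
instance : One (PadicAffine p) := ⟨⟨0, 1⟩⟩

/-- The inverse substitution `(a, u)⁻¹ = (-u⁻¹ a, u⁻¹)`. [cite: MochizukiSemiAnbd2006, §0 p.6] -/
instance : Inv (PadicAffine p) := ⟨fun x => ⟨-(((x.u⁻¹ : ℤ_[p]ˣ) : ℤ_[p]) * x.a), x.u⁻¹⟩⟩

/-- Translation part of a product. [cite: MochizukiSemiAnbd2006, §0 p.6] -/
@[simp] theorem mul_a (x y : PadicAffine p) : (x * y).a = x.a + (x.u : ℤ_[p]) * y.a := rfl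

/-- Linear part of a product. [cite: MochizukiSemiAnbd2006, §0 p.6] -/
@[simp] theorem mul_u (x y : PadicAffine p) : (x * y).u = x.u * y.u := rfl

/-- Translation part of `1`. [cite: MochizukiSemiAnbd2006, §0 p.6] -/
@[simp] theorem one_a : (1 : PadicAffine p).a = 0 := rfl

/-- Linear part of `1`. [cite: MochizukiSemiAnbd2006, §0 p.6] -/
@[simp] theorem one_u : (1 : PadicAffine p).u = 1 := rfl

/-- Translation part of an inverse. [cite: MochizukiSemiAnbd2006, §0 p.6] -/
@[simp] theorem inv_a (x : PadicAffine p) :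
    x⁻¹.a = -(((x.u⁻¹ : ℤ_[p]ˣ) : ℤ_[p]) * x.a) := rfl

/-- Linear part of an inverse. [cite: MochizukiSemiAnbd2006, §0 p.6] -/
@[simp] theorem inv_u (x : PadicAffine p) : x⁻¹.u = x.u⁻¹ := rfl

/-- `Aff(ℤ_p)` is a group (the semidirect product `ℤ_p ⋊ ℤ_pˣ`). [cite: MochizukiSemiAnbd2006, §0 p.6] -/
instance : Group (PadicAffine p) where
  mul_assoc x y z := by
    ext
    · simp only [mul_a, mul_u, Units.val_mul]; ring
    · simp only [mul_u, mul_assoc]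
  one_mul x := by
    ext
    · simp
    · simp
  mul_one x := by
    ext
    · simp
    · simp
  inv_mul_cancel x := by
    ext
    · simp
    · simp

/-! ### Topology: the coordinates `(a, u) ∈ ℤ_p × ℤ_p` -/

/-- The coordinate map `(a, u) ↦ (a, u) ∈ ℤ_p × ℤ_p`. [cite: MochizukiSemiAnbd2006, §0 p.6] -/
def coord (x : PadicAffine p) : ℤ_[p] × ℤ_[p] := (x.a, (x.u : ℤ_[p]))

/-- The coordinate map is injective. [cite: MochizukiSemiAnbd2006, §0 p.6] -/
theorem coord_injective : Function.Injective (coord (p := p)) := by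
  intro x y h
  simp only [coord, Prod.mk.injEq] at h
  exact PadicAffine.ext h.1 (Units.ext h.2)

/-- The range of the coordinate map: all `(a, v)` with `v` a unit. [cite: MochizukiSemiAnbd2006, §0 p.6] -/
theorem range_coord : range (coord (p := p)) = {q | IsUnit q.2} := by
  ext q
  constructor
  · rintro ⟨x, rfl⟩
    exact x.u.isUnit
  · intro hq
    exact ⟨⟨q.1, hq.unit⟩, by simp [coord]⟩

/-- The topology of `Aff(ℤ_p)`: induced by the coordinates from `ℤ_p × ℤ_p`. [cite: MochizukiSemiAnbd2006, §0 p.6] -/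
instance : TopologicalSpace (PadicAffine p) := TopologicalSpace.induced coord inferInstance

/-- The coordinate map is inducing (by definition of the topology). [cite: MochizukiSemiAnbd2006, §0 p.6] -/
theorem isInducing_coord : IsInducing (coord (p := p)) := ⟨rfl⟩

/-- The coordinate map is an embedding. [cite: MochizukiSemiAnbd2006, §0 p.6] -/
theorem isEmbedding_coord : IsEmbedding (coord (p := p)) := ⟨isInducing_coord, coord_injective⟩

/-- The coordinate map is continuous. [cite: MochizukiSemiAnbd2006, §0 p.6] -/
theorem continuous_coord : Continuous (coord (p := p)) := continuous_induced_dom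

/-- The translation part is continuous. [cite: MochizukiSemiAnbd2006, §0 p.6] -/
theorem continuous_a : Continuous fun x : PadicAffine p => x.a :=
  continuous_fst.comp continuous_coord

/-- The linear part, as an element of `ℤ_p`, is continuous. [cite: MochizukiSemiAnbd2006, §0 p.6] -/
theorem continuous_uval : Continuous fun x : PadicAffine p => (x.u : ℤ_[p]) :=
  continuous_snd.comp continuous_coord

/-- The inverse of the linear part, as an element of `ℤ_p`, is continuous (inversion is continuous
on the units of the complete normed ring `ℤ_p`). [cite: MochizukiSemiAnbd2006, §0 p.6] -/
theorem continuous_uinv : Continuous fun x : PadicAffine p => ((x.u⁻¹ : ℤ_[p]ˣ) : ℤ_[p]) := by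
  have e : (fun x : PadicAffine p => ((x.u⁻¹ : ℤ_[p]ˣ) : ℤ_[p])) =
      fun x => Ring.inverse (x.u : ℤ_[p]) := by
    funext x
    exact (Ring.inverse_unit x.u).symm
  rw [e]
  refine continuous_iff_continuousAt.2 fun x => ?_
  exact ContinuousAt.comp (f := fun y : PadicAffine p => (y.u : ℤ_[p])) (x := x)
    (NormedRing.inverse_continuousAt x.u) continuous_uval.continuousAt

/-- `Aff(ℤ_p)` is a topological group. [cite: MochizukiSemiAnbd2006, §0 p.6] -/
instance : IsTopologicalGroup (PadicAffine p) where
  continuous_mul := by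
    rw [continuous_induced_rng]
    have e : (coord ∘ fun q : PadicAffine p × PadicAffine p => q.1 * q.2) =
        fun q => (q.1.a + (q.1.u : ℤ_[p]) * q.2.a, (q.1.u : ℤ_[p]) * (q.2.u : ℤ_[p])) := by
      funext q
      simp [coord]
    rw [e]
    exact ((continuous_a.comp continuous_fst).add
      ((continuous_uval.comp continuous_fst).mul (continuous_a.comp continuous_snd))).prodMk
      ((continuous_uval.comp continuous_fst).mul (continuous_uval.comp continuous_snd))
  continuous_inv := by
    rw [continuous_induced_rng]
    have e : (coord ∘ fun x : PadicAffine p => x⁻¹) =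
        fun x => (-(((x.u⁻¹ : ℤ_[p]ˣ) : ℤ_[p]) * x.a), ((x.u⁻¹ : ℤ_[p]ˣ) : ℤ_[p])) := by
      funext x
      simp [coord]
    rw [e]
    exact (continuous_uinv.mul continuous_a).neg.prodMk continuous_uinv

/-- `Aff(ℤ_p)` is Hausdorff. [cite: MochizukiSemiAnbd2006, §0 p.6] -/
instance : T2Space (PadicAffine p) := isEmbedding_coord.t2Space

/-- `Aff(ℤ_p)` is totally disconnected. [cite: MochizukiSemiAnbd2006, §0 p.6] -/
instance : TotallyDisconnectedSpace (PadicAffine p) :=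
  isEmbedding_coord.isTotallyDisconnected_range.mp
    (isTotallyDisconnected_of_totallyDisconnectedSpace _)

/-- `Aff(ℤ_p)` is compact: its coordinates form the closed subset `ℤ_p × ℤ_pˣ` (the units are the
unit sphere) of the compact space `ℤ_p × ℤ_p`. [cite: MochizukiSemiAnbd2006, §0 p.6] -/
instance : CompactSpace (PadicAffine p) := by
  constructor
  rw [isInducing_coord.isCompact_iff, image_univ, range_coord]
  have hc : IsClosed {q : ℤ_[p] × ℤ_[p] | IsUnit q.2} := by
    have e : {q : ℤ_[p] × ℤ_[p] | IsUnit q.2} = (fun q : ℤ_[p] × ℤ_[p] => ‖q.2‖) ⁻¹' {1} := by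
      ext q
      simp [PadicInt.isUnit_iff]
    rw [e]
    exact isClosed_singleton.preimage (continuous_norm.comp continuous_snd)
  exact hc.isCompact

/-! ### The congruence subgroups `Γ_n` -/

variable (p) in
/-- The ideal `pⁿ ℤ_p`. [cite: MochizukiSemiAnbd2006, §0 p.6] -/
def I (n : ℕ) : Ideal ℤ_[p] := Ideal.span {(p : ℤ_[p]) ^ n}

/-- Membership in `pⁿ ℤ_p` is reduction to `0` modulo `pⁿ`. [cite: MochizukiSemiAnbd2006, §0 p.6] -/
theorem mem_I_iff (n : ℕ) (z : ℤ_[p]) : z ∈ I p n ↔ PadicInt.toZModPow n z = 0 := by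
  rw [I, ← PadicInt.ker_toZModPow, RingHom.mem_ker]

/-- Membership in `pⁿ ℤ_p` is the norm bound `‖z‖ ≤ p⁻ⁿ`. [cite: MochizukiSemiAnbd2006, §0 p.6] -/
theorem mem_I_iff_norm (n : ℕ) (z : ℤ_[p]) : z ∈ I p n ↔ ‖z‖ ≤ (p : ℝ) ^ (-(n : ℤ)) :=
  (PadicInt.norm_le_pow_iff_mem_span_pow z n).symm

variable (p) in
/-- The congruence subgroup `Γ_n = {(a, u) : a ∈ pⁿℤ_p, u ∈ 1 + pⁿℤ_p}`. [cite: MochizukiSemiAnbd2006, §0 p.6] -/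
def level (n : ℕ) : Subgroup (PadicAffine p) where
  carrier := {x | x.a ∈ I p n ∧ (x.u : ℤ_[p]) - 1 ∈ I p n}
  one_mem' := by simp
  mul_mem' := by
    intro x y hx hy
    refine ⟨?_, ?_⟩
    · rw [mul_a]
      exact (I p n).add_mem hx.1 ((I p n).mul_mem_left _ hy.1)
    · have e : ((x * y).u : ℤ_[p]) - 1 =
          (x.u : ℤ_[p]) * ((y.u : ℤ_[p]) - 1) + ((x.u : ℤ_[p]) - 1) := by
        rw [mul_u, Units.val_mul]; ring
      rw [e]
      exact (I p n).add_mem ((I p n).mul_mem_left _ hy.2) hx.2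
  inv_mem' := by
    intro x hx
    refine ⟨?_, ?_⟩
    · rw [inv_a]
      exact (I p n).neg_mem ((I p n).mul_mem_left _ hx.1)
    · have e : ((x⁻¹).u : ℤ_[p]) - 1 = -(((x.u⁻¹ : ℤ_[p]ˣ) : ℤ_[p]) * ((x.u : ℤ_[p]) - 1)) := by
        rw [inv_u, mul_sub, Units.inv_mul, mul_one]; ring
      rw [e]
      exact (I p n).neg_mem ((I p n).mul_mem_left _ hx.2)

/-- Membership in `Γ_n`. [cite: MochizukiSemiAnbd2006, §0 p.6] -/
theorem mem_level_iff (n : ℕ) (x : PadicAffine p) :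
    x ∈ level p n ↔ x.a ∈ I p n ∧ (x.u : ℤ_[p]) - 1 ∈ I p n := Iff.rfl

/-- `Γ_n` is normal. [cite: MochizukiSemiAnbd2006, §0 p.6] -/
instance level_normal (n : ℕ) : (level p n).Normal := by
  refine ⟨fun x hx c => ?_⟩
  refine ⟨?_, ?_⟩
  · have h : (c.u : ℤ_[p]) * ((c.u⁻¹ : ℤ_[p]ˣ) : ℤ_[p]) = 1 := Units.mul_inv c.u
    have e : (c * x * c⁻¹).a = (c.u : ℤ_[p]) * x.a - ((x.u : ℤ_[p]) - 1) * c.a := by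
      simp only [mul_a, mul_u, inv_a, Units.val_mul]
      linear_combination (-((x.u : ℤ_[p]) * c.a)) * h
    rw [e]
    exact (I p n).sub_mem ((I p n).mul_mem_left _ hx.1) ((I p n).mul_mem_right _ hx.2)
  · have e : (c * x * c⁻¹).u = x.u := by
      rw [mul_u, mul_u, inv_u, mul_comm c.u, mul_assoc, mul_inv_cancel, mul_one]
    rw [e]
    exact hx.2

/-- `Γ_n` in coordinates: the preimage of the product of the closed balls of radius `p⁻ⁿ` about
`0` and `1`. [cite: MochizukiSemiAnbd2006, §0 p.6] -/
theorem coe_level_eq (n : ℕ) : (level p n : Set (PadicAffine p)) =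
    coord ⁻¹' (Metric.closedBall (0 : ℤ_[p]) ((p : ℝ) ^ (-(n : ℤ))) ×ˢ
      Metric.closedBall (1 : ℤ_[p]) ((p : ℝ) ^ (-(n : ℤ)))) := by
  ext x
  simp only [SetLike.mem_coe, mem_level_iff, mem_I_iff_norm, mem_preimage, coord, mem_prod,
    Metric.mem_closedBall, dist_eq_norm, sub_zero]

/-- `Γ_n` is open. [cite: MochizukiSemiAnbd2006, §0 p.6] -/
theorem isOpen_level (n : ℕ) : IsOpen (level p n : Set (PadicAffine p)) := by
  rw [coe_level_eq]
  have hr : (p : ℝ) ^ (-(n : ℤ)) ≠ 0 :=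
    zpow_ne_zero _ (Nat.cast_ne_zero.mpr (Fact.out : p.Prime).ne_zero)
  exact ((IsUltrametricDist.isOpen_closedBall _ hr).prod
    (IsUltrametricDist.isOpen_closedBall _ hr)).preimage continuous_coord

/-- **The `Γ_n` form a basis of neighbourhoods of `1`**: every open set containing `1` contains
some `Γ_n` with `n ≥ 1`. [cite: MochizukiSemiAnbd2006, §0 p.6] -/
theorem exists_level_subset {V : Set (PadicAffine p)} (hV : IsOpen V) (h1 : (1 : PadicAffine p) ∈ V) :
    ∃ n : ℕ, 0 < n ∧ (level p n : Set (PadicAffine p)) ⊆ V := by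
  obtain ⟨W, hW, rfl⟩ := isOpen_induced_iff.mp hV
  have h1W : ((0 : ℤ_[p]), (1 : ℤ_[p])) ∈ W := by simpa [coord] using h1
  obtain ⟨ε, hε, hball⟩ := Metric.isOpen_iff.mp hW _ h1W
  have hp1 : (1 : ℝ) < p := Nat.one_lt_cast.mpr (Fact.out : p.Prime).one_lt
  obtain ⟨n, hn⟩ := exists_pow_lt_of_lt_one hε (inv_lt_one_of_one_lt₀ hp1)
  refine ⟨n + 1, Nat.succ_pos n, ?_⟩
  rw [coe_level_eq]
  refine preimage_mono (Subset.trans ?_ hball)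
  intro q hq
  rw [mem_prod, Metric.mem_closedBall, Metric.mem_closedBall] at hq
  rw [Metric.mem_ball, Prod.dist_eq]
  have hlt : (p : ℝ) ^ (-((n + 1 : ℕ) : ℤ)) < ε := by
    rw [zpow_neg, zpow_natCast, ← inv_pow]
    calc ((p : ℝ)⁻¹) ^ (n + 1) ≤ ((p : ℝ)⁻¹) ^ n :=
          pow_le_pow_of_le_one (inv_nonneg.mpr (Nat.cast_nonneg p))
            (inv_lt_one_of_one_lt₀ hp1).le (Nat.le_succ n)
      _ < ε := hn
  exact max_lt (hq.1.trans_lt hlt) (hq.2.trans_lt hlt)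

/-- Variant for open subgroups. [cite: MochizukiSemiAnbd2006, §0 p.6] -/
theorem exists_level_le (V : Subgroup (PadicAffine p)) (hV : IsOpen (V : Set (PadicAffine p))) :
    ∃ n : ℕ, 0 < n ∧ level p n ≤ V := by
  obtain ⟨n, hn, h⟩ := exists_level_subset hV V.one_mem
  exact ⟨n, hn, fun x hx => h hx⟩

/-! ### Finite quotients of unbounded order -/

/-- The reduction of the coordinates modulo `pⁿ`. [cite: MochizukiSemiAnbd2006, §0 p.6] -/
def red (n : ℕ) (x : PadicAffine p) : ZMod (p ^ n) × ZMod (p ^ n) :=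
  (PadicInt.toZModPow n x.a, PadicInt.toZModPow n (x.u : ℤ_[p]))

/-- Two elements lie in the same left coset of `Γ_n` iff their coordinates agree modulo `pⁿ`.
[cite: MochizukiSemiAnbd2006, §0 p.6] -/
theorem inv_mul_mem_level_iff (n : ℕ) (x y : PadicAffine p) :
    x⁻¹ * y ∈ level p n ↔ red n x = red n y := by
  have hu : (x.u : ℤ_[p]) * ((x.u⁻¹ : ℤ_[p]ˣ) : ℤ_[p]) = 1 := Units.mul_inv x.u
  have ea : (x⁻¹ * y).a = ((x.u⁻¹ : ℤ_[p]ˣ) : ℤ_[p]) * (y.a - x.a) := by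
    simp only [mul_a, inv_a, inv_u]; ring
  have eu : ((x⁻¹ * y).u : ℤ_[p]) - 1 = ((x.u⁻¹ : ℤ_[p]ˣ) : ℤ_[p]) * ((y.u : ℤ_[p]) - x.u) := by
    rw [mul_u, inv_u, Units.val_mul, mul_sub, Units.inv_mul]
  rw [mem_level_iff, ea, eu, red, red, Prod.mk.injEq]
  constructor
  · rintro ⟨h1, h2⟩
    have h1' : y.a - x.a ∈ I p n := by
      have := (I p n).mul_mem_left (x.u : ℤ_[p]) h1
      rwa [← mul_assoc, hu, one_mul] at this
    have h2' : (y.u : ℤ_[p]) - x.u ∈ I p n := by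
      have := (I p n).mul_mem_left (x.u : ℤ_[p]) h2
      rwa [← mul_assoc, hu, one_mul] at this
    rw [mem_I_iff, map_sub, sub_eq_zero] at h1' h2'
    exact ⟨h1'.symm, h2'.symm⟩
  · rintro ⟨h1, h2⟩
    have h1' : y.a - x.a ∈ I p n := by rw [mem_I_iff, map_sub, sub_eq_zero]; exact h1.symm
    have h2' : (y.u : ℤ_[p]) - x.u ∈ I p n := by rw [mem_I_iff, map_sub, sub_eq_zero]; exact h2.symm
    exact ⟨(I p n).mul_mem_left _ h1', (I p n).mul_mem_left _ h2'⟩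

/-- The quotient `Aff(ℤ_p)/Γ_n` embeds into `(ℤ/pⁿ)²`; in particular it is finite. [cite: MochizukiSemiAnbd2006, §0 p.6] -/
theorem finite_quotient_level (n : ℕ) : Finite (PadicAffine p ⧸ level p n) := by
  classical
  let f : PadicAffine p ⧸ level p n → ZMod (p ^ n) × ZMod (p ^ n) :=
    Quotient.lift (red n) (fun x y h => (inv_mul_mem_level_iff n x y).mp
      (QuotientGroup.leftRel_apply.mp h))
  haveI : NeZero (p ^ n) := ⟨pow_ne_zero n (Fact.out : p.Prime).ne_zero⟩
  refine Finite.of_injective f ?_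
  intro q₁ q₂ h
  induction q₁ using Quotient.inductionOn with
  | h x =>
    induction q₂ using Quotient.inductionOn with
    | h y =>
      exact Quotient.sound (QuotientGroup.leftRel_apply.mpr ((inv_mul_mem_level_iff n x y).mpr h))

/-- The translations `(k, 1)`, `0 ≤ k < pⁿ`, are pairwise distinct modulo `Γ_n`; hence
`[Aff(ℤ_p) : Γ_n] ≥ pⁿ`. [cite: MochizukiSemiAnbd2006, §0 p.6] -/
theorem pow_le_card_quotient_level (n : ℕ) : p ^ n ≤ Nat.card (PadicAffine p ⧸ level p n) := by
  haveI := finite_quotient_level (p := p) n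
  let t : Fin (p ^ n) → PadicAffine p ⧸ level p n :=
    fun k => QuotientGroup.mk ⟨((k : ℕ) : ℤ_[p]), 1⟩
  have ht : Function.Injective t := by
    intro k l h
    have h' := (inv_mul_mem_level_iff n _ _).mp (QuotientGroup.eq.mp h)
    simp only [red, Prod.mk.injEq, map_natCast] at h'
    have hk := congrArg ZMod.val h'.1
    rw [ZMod.val_natCast, ZMod.val_natCast, Nat.mod_eq_of_lt k.2, Nat.mod_eq_of_lt l.2] at hk
    exact Fin.ext hk
  simpa using Nat.card_le_card_of_injective t ht

/-! ### Slimness -/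

/-- `p ^ n ≠ 0` in `ℤ_p`. [cite: MochizukiSemiAnbd2006, §0 p.6] -/
theorem pow_p_ne_zero (n : ℕ) : ((p : ℤ_[p]) ^ n) ≠ 0 :=
  pow_ne_zero n (Nat.cast_ne_zero.mpr (Fact.out : p.Prime).ne_zero)

/-- For `n ≥ 1`, `pⁿ` is a non-unit of `ℤ_p`. [cite: MochizukiSemiAnbd2006, §0 p.6] -/
theorem pow_p_mem_nonunits {n : ℕ} (hn : 0 < n) : ((p : ℤ_[p]) ^ n) ∈ nonunits ℤ_[p] := by
  rw [PadicInt.mem_nonunits, norm_pow, PadicInt.norm_p]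
  have hp1 : (1 : ℝ) < p := Nat.one_lt_cast.mpr (Fact.out : p.Prime).one_lt
  exact pow_lt_one₀ (inv_nonneg.mpr (Nat.cast_nonneg p)) (inv_lt_one_of_one_lt₀ hp1) hn.ne'

/-- The translation `(pⁿ, 1)` lies in `Γ_n`. [cite: MochizukiSemiAnbd2006, §0 p.6] -/
theorem transl_mem_level (n : ℕ) : (⟨(p : ℤ_[p]) ^ n, 1⟩ : PadicAffine p) ∈ level p n :=
  ⟨Ideal.mem_span_singleton_self _, by simp⟩

/-- The homothety `(0, 1 - pⁿ)` (`n ≥ 1`) lies in `Γ_n`. [cite: MochizukiSemiAnbd2006, §0 p.6] -/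
theorem homoth_mem_level {n : ℕ} (hn : 0 < n) :
    (⟨0, (IsLocalRing.isUnit_one_sub_self_of_mem_nonunits _ (pow_p_mem_nonunits hn)).unit⟩ :
      PadicAffine p) ∈ level p n := by
  refine ⟨Ideal.zero_mem _, ?_⟩
  rw [IsUnit.unit_spec, sub_sub_cancel_left]
  exact (I p n).neg_mem (Ideal.mem_span_singleton_self _)

/-- **`Aff(ℤ_p)` is slim**: the centraliser of every open subgroup is trivial.  An open subgroup
contains some `Γ_n` (`n ≥ 1`), hence `(pⁿ, 1)` and `(0, 1 - pⁿ)`; commuting with the first forces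
`u = 1`, with the second `a = 0`. [cite: MochizukiFrdI2008, §0 p.13] -/
theorem centralizer_eq_bot_of_isOpen (U : Subgroup (PadicAffine p))
    (hU : IsOpen (U : Set (PadicAffine p))) :
    Subgroup.centralizer (U : Set (PadicAffine p)) = ⊥ := by
  obtain ⟨n, hn, hle⟩ := exists_level_le U hU
  rw [eq_bot_iff]
  intro z hz
  rw [Subgroup.mem_centralizer_iff] at hz
  rw [Subgroup.mem_bot]
  -- commuting with the translation `(pⁿ, 1)`
  have hb := congrArg PadicAffine.a (hz _ (hle (transl_mem_level n)))
  simp only [mul_a, Units.val_one, one_mul] at hb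
  -- hb : p^n + z.a = z.a + z.u * p^n
  have hu1 : (z.u : ℤ_[p]) = 1 := by
    have h0 : ((z.u : ℤ_[p]) - 1) * (p : ℤ_[p]) ^ n = 0 := by linear_combination hb.symm
    rcases mul_eq_zero.mp h0 with h | h
    · exact sub_eq_zero.mp h
    · exact absurd h (pow_p_ne_zero n)
  -- commuting with the homothety `(0, 1 - pⁿ)`
  have hw := congrArg PadicAffine.a (hz _ (hle (homoth_mem_level hn)))
  simp only [mul_a, IsUnit.unit_spec, mul_zero, add_zero, zero_add] at hw
  -- hw : (1 - p^n) * z.a = z.a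
  have ha0 : z.a = 0 := by
    have h0 : (p : ℤ_[p]) ^ n * z.a = 0 := by linear_combination -hw
    rcases mul_eq_zero.mp h0 with h | h
    · exact absurd h (pow_p_ne_zero n)
    · exact h
  ext
  · rw [ha0, one_a]
  · rw [one_u, Units.val_one, hu1]

end PadicAffine

end Literature.GroupTheory.SpecificGroups

end
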